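import Mathlib
import HarnessLib
import HarnessLib.Audit
import Summits.ValiantsHypothesis.Statement
import Literature.Computability.AlgebraicComplexity.OrbitClosure
import HarnessLib.Audit.Status.Attr

/-!
Route: BorderApolarity

# Route BorderApolarity — Borel-fixed border apolarity for the orbit closure of det_m — no fixed
limit of det_m^⊥ inside the padded permanent's annihilator

It suffices to show X = FixedWitnessObstructionQP ("no Borel-fixed border-apolar witness in the
quasi-polynomial window"): for every c, for all large n and every m with n ≤ m ≤ 2^((log₂ n + c)^c),
there is NO pair (P•, J) where P_t ∈ GL_(m²)·det_m is a sequence of translates of the determinant, J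
= (J_k)_(k ≤ m) is the degree-wise Kuratowski (= Grassmannian) limit of the annihilator spaces
Ann_k(P_t) = {D ∈ ℂ[∂]_k : D·P_t = 0} (a point of Z_det := closure of GL·[det_m^⊥] in the
multigraded Hilbert scheme, written sequentially), J is stable under the explicit connected solvable
group H₀ = H₀(n,m) ⊆ Stab(pp) (substitutions lower-triangular for the order "padding variable ℓ =
X₀₀ and the per-block Y first, the m²−n²−1 unused variables z last", pure scalings on ℓ and Y with a
rank-one pattern a_i b_j on Y, character ℓ^(m−n)·Π_i (a_i b_i) = 1, acting on operators by D ↦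
D∘Mᵀ), and J_k ⊆ pp^⊥_k for all k ≤ m, pp := X₀₀^(m−n) per_n. This realises card
orbit-closure-border-apolarity (its X3; X1 = support item BorelFixedBorderApolarity, X2 = crux
ToricFixedPoints). By Borel-fixed border apolarity (BuczynskaBuczynski2021 Thm 1 and Thm 31
transplanted from Slip to Z_det) pp ∈ Δ(det_m) forces such a witness, so X gives the
quasi-polynomial Mulmuley–Sohoni thesis GctThesis of route GCTMult and hence VH through the proved
chain gct_assembly + hub.
Lean: `∀ c : ℕ, ∃ n₀ : ℕ, ∀ n ≥ n₀, ∀ (m : ℕ) [NeZero m], n ≤ m → m ≤ 2 ^ ((Nat.log 2 n + c) ^ c) →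
let act := fun (D f : MvPolynomial (Fin m × Fin m) ℂ) => ∑ e ∈ D.support, ∑ d ∈ f.support,
MvPolynomial.monomial (d - e) (MvPolynomial.coeff e D * MvPolynomial.coeff d f * ∏ i ∈ e.support,
(Nat.descFactorial (d i) (e i) : ℂ)); let rk := fun (p : Fin m × Fin m) => (if (m - n ≤ (p.1 : ℕ) ∧
m - n ≤ (p.2 : ℕ)) ∨ p = (0, 0) then 0 else m * m) + ((p.1 : ℕ) * m + (p.2 : ℕ)); ¬ ∃ (P : ℕ →
MvPolynomial (Fin m × Fin m) ℂ) (J : ℕ → Set (MvPolynomial (Fin m × Fin m) ℂ)), (∀ t : ℕ, P t ∈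
Literature.Computability.AlgebraicComplexity.glOrbit (Fin m × Fin m) ℂ
(Literature.Computability.AlgebraicComplexity.detPoly (Fin m) ℂ)) ∧ (∀ k ≤ m, ∀ D ∈ J k, ∃ Ds : ℕ →
MvPolynomial (Fin m × Fin m) ℂ, (∀ t, (Ds t).IsHomogeneous k ∧ act (Ds t) (P t) = 0) ∧
Filter.Tendsto (fun t => Literature.Computability.AlgebraicComplexity.coeffVec (Ds t)) Filter.atTop
(nhds (Literature.Computability.AlgebraicComplexity.coeffVec D))) ∧ (∀ k ≤ m, ∀ (D : MvPolynomial
(Fin m × Fin m) ℂ) (φ : ℕ → ℕ) (Ds : ℕ → MvPolynomial (Fin m × Fin m) ℂ), StrictMono φ → (∀ t, (Ds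
t).IsHomogeneous k ∧ act (Ds t) (P (φ t)) = 0) → Filter.Tendsto (fun t =>
Literature.Computability.AlgebraicComplexity.coeffVec (Ds t)) Filter.atTop (nhds
(Literature.Computability.AlgebraicComplexity.coeffVec D)) → D ∈ J k) ∧ (∀ A :
Matrix.GeneralLinearGroup (Fin m × Fin m) ℂ, let M : Matrix (Fin m × Fin m) (Fin m × Fin m) ℂ := A;
(∀ i j : Fin m × Fin m, M j i ≠ 0 → rk j ≤ rk i) → (∀ i j : Fin m × Fin m, ((m - n ≤ (i.1 : ℕ) ∧ m -
n ≤ (i.2 : ℕ)) ∨ i = (0, 0)) → j ≠ i → M j i = 0) → (∀ i k j l : Fin m, m - n ≤ (i : ℕ) → m - n ≤ (k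
: ℕ) → m - n ≤ (j : ℕ) → m - n ≤ (l : ℕ) → M (i, j) (i, j) * M (k, l) (k, l) = M (i, l) (i, l) * M
(k, j) (k, j)) → M (0, 0) (0, 0) ^ (m - n) * ∏ i ∈ Finset.univ.filter (fun i : Fin m => m - n ≤ (i :
ℕ)), M (i, i) (i, i) = 1 → ∀ k ≤ m, ∀ D ∈ J k, Literature.Computability.AlgebraicComplexity.linSubst
(Fin m × Fin m) ℂ Mᵀ D ∈ J k) ∧ (∀ k ≤ m, ∀ D ∈ J k, act D
(Literature.Computability.AlgebraicComplexity.paddedPerPoly ℂ n m) = 0)`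

## Assembly
Pure logic (planner-checked sorry-free, axioms {propext, Classical.choice, Quot.sound}). Deciding
theorem since the 2026-08-16 unused-crux repair: closes (ToricFixedPoints)
(ToricWitnessObstructionQP) (BorelFixedBorderApolarity) (GctBridge) : ValiantsHypothesis. Step 1
(the glued split, = support item ToricReduction): given c take n₀' = max(n₀(c), 3); for n ≥ n₀' and
n ≤ m ≤ 2^((log₂ n + c)^c) a witness (P•, J) is turned by ToricFixedPoints into a toric one
u·diag((t+2)^w)·g·det_m with the same J, which ToricWitnessObstructionQP forbids — this proves
FixedWitnessObstructionQP (the thesis X) inside the proof term. Step 2 (unchanged): membership pp ∈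
Δ(det_m) would give a witness by BorelFixedBorderApolarity, contradicting X; hence the qp
Mulmuley–Sohoni non-membership, and GctBridge gives ValiantsHypothesis. ToricFixedPoints (the
structural engine) is thereby load-bearing; the (3,5) test instance BorderDcPerThreeSix was dropped
as an item (a finite instance cannot feed the asymptotic hypotheses) and survives as the
cheapest-falsifier computation. A direct proof of X still closes the line after a one-line re-glue
(closes back to (X)(Borel)(Bridge)).

Rationale: WHY THIS LINE. Mechanism: apolarity keeps the apolar IDEAL where flattenings / shifted partials keep
only its Hilbert function — and HF(per_m^⊥) = HF(det_m^⊥) is exactly why rank methods are blind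
(LandsbergGCT2017 §6.2, Shafiei2015); pp ∈ Δ(det_m) iff some limit J of translates of det_m^⊥ lies
inside pp^⊥ (border apolarity for ORBIT CLOSURES: the secant-variety theorem BuczynskaBuczynski2021
Thm 1/Thm 31, arXiv:1910.01944, with Slip_r replaced by Z_det = closure of GL·[det^⊥] in the
multigraded Hilbert scheme, MillerSturmfels2005 ch. 18), and because {J ∈ Z_det : J ⊆ pp^⊥} is
projective and Stab(pp)-stable, Borel's fixed point theorem (Borel1991 §10.4) lets J be taken
H₀-fixed: the hypothetical GCT witness acquires a combinatorial normal form (ℤ^(2n−1) × ℤ^N torus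
grading by row/column contents and z-multidegree, stability under the unipotent "lower everything
into the unused variables" operators). Imported areas: Macaulay inverse systems / apolarity and
multigraded Hilbert schemes (commutative algebra), Borel fixed points and one-parameter
degenerations (algebraic groups, Gröbner/toric degenerations: Green1998GenericInitialIdeals), the
ConnerHarperLandsberg2023 (arXiv:1911.07981) fixed-ideal enumeration technology that beat all
Koszul-flattening bounds for M_⟨3⟩ and det_3. What it does that prior routes do not:
GCTMult/IntegralGCT compare coordinate rings ℂ[Δ] through multiplicities (representation theory,
barred at the occurrence level by BIP2019); DetQP uses local differential invariants of the
hypersurface; this line certifies non-membership by the NON-EXISTENCE OF A FIXED LIMIT IDEAL, an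
object on the operator side that no route or negative (index empty) touches, and it comes with a
structural engine (crux ToricFixedPoints: fixed points of Z_det are one-parameter-subgroup limits,
i.e. Gröbner degenerations in_w((g·det_m)^⊥), the family containing End(W)·det_m and the LMR13/HL16
boundary components P_Λ = lim det(A_skew + tS)).

RANKED CRUXES. #2 FixedWitnessObstructionQP (crux) — card X3 — for every c there is n₀ such that for
n ≥ n₀ and n ≤ m ≤ 2^((log₂ n + c)^c) no H₀(n,m)-stable Kuratowski limit J = lim Ann(P_t) (P_t ∈
GL·det_m) has J_k ⊆ Ann_k(X₀₀^(m−n) per_n) for all k ≤ m (the thesis X). [difficulty: open-problem]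
(why it might fail: Pointwise equivalent to pp ∉ Δ(det_m) (support items): false if border-dc(per_n)
≤ 2^polylog n, which nothing excludes (m²/2 ≤ bdc ≤ 2^n−1); and H₀-fixed points of Z_det_m may be as
wild as ∂Δ(det_m) itself (padded forms are cones, LandsbergGCT2017 §6.5.2).)
[BuczynskaBuczynski2021, ConnerHarperLandsberg2023, LandsbergManivelRessayre2013, LandsbergGCT2017,
Grenet2011, MulmuleySohoni2001]
#3 ToricFixedPoints (crux) — card X2 (structure of fixed points) — for 3 ≤ n ≤ m, every
H₀(n,m)-stable point J of Z_det_m (Kuratowski limit of Ann(P_t), P_t ∈ GL·det_m) is a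
one-parameter-subgroup limit of an interior point: J = lim_t Ann(u·diag((t+2)^w)·g·det_m) for some
u, g ∈ GL_(m²) and integer weights w, i.e. a translate of a Gröbner degeneration in_w((g·det_m)^⊥);
this makes the fixed-point set of crux 2 an explicitly parametrised (toric) family containing
End(W)·det_m and the P_Λ-type boundary components. [difficulty: L] (why it might fail: Orbit
closures contain points reached only by iterated degenerations (G((t)) = G[[t]]·T·G[[t]] does not
reduce to one 1-PSG of a fixed translate) and non-saturated limit ideals abound
(JelisiejewMandziuk2025); one H₀-fixed such point of Z_det_m, maybe already at m = 3 or 4, refutes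
it.) [HuttenhainLairez2016, LandsbergManivelRessayre2013, JelisiejewMandziuk2025,
HuangMichalekVentura2020, Green1998GenericInitialIdeals, LandsbergGCT2017]
#4 ToricWitnessObstructionQP (crux; added 2026-08-16 by route-repair, item
stmt-ValiantsHypothesis-14753) — the thesis X in TORIC NORMAL FORM, the child of crux 2
complementary to crux 3: for every c there is n₀ such that for n ≥ n₀ and n ≤ m ≤ 2^((log₂ n + c)^c)
there are no u, g ∈ GL_(m²), integer weights w and J = lim_t Ann(Q_t) (degree-wise Kuratowski limit
along the toric curve Q_t := u·diag((t+2)^w)·g·det_m, a translate of the torus/Gröbner degeneration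
in_w((g·det_m)^⊥)) with J H₀(n,m)-stable and J_k ⊆ Ann_k(X₀₀^(m−n) per_n) for all k ≤ m. Sandwich:
FixedWitnessObstructionQP ⇒ #4 (toric curves lie in GL·det_m, landed `toricCurve_mem_glOrbit`,
Theorems/ToricFixedPoints/Negative/WithoutUpperLimitFalse.lean) and #3 ∧ #4 ⇒ #2 (support
ToricReduction, pure logic). By the landed socle step
(Theorems/BorderApolarityFixedWitnessObstructionQPSocleMax.lean) a toric witness forces pp =
u′·in_w′(g′·det_m) as an extremal weighted component, so #4 says: no extremal initial-form
representation of the padded permanent at quasi-polynomial size; the 5778 lead line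
toric-face-debordering (Cruxes/FixedWitnessObstructionQP/NOTES.md) derives it from a weight bound
(its stub_weightBoundMax, 'toric border ⇒ affine at qp cost') plus eventual super-qp dc(per_n) —
both unfiled, tenure decision. [difficulty: open-problem] (why it might fail: sandwiched between
GctThesis and crux 2 up to the normal form — false iff padded permanents are extremal initial forms
in_w(g·det_m) at m ≤ 2^polylog n infinitely often; Grenet's 2^n−1 ABP is already a 0/1-weight toric
representation and nothing known bounds the weight/size trade-off.) [MulmuleySohoni2001, Grenet2011,
Green1998GenericInitialIdeals, BuczynskaBuczynski2021, LandsbergManivelRessayre2013,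
LandsbergGCT2017]
#9 ToricReduction (support; added 2026-08-16, item stmt-ValiantsHypothesis-14757) — GLUE, pure
logic, provable now (planner scratch proof rc 0; the same ten lines are inlined as step 1 of
`closes`): ToricFixedPoints → ToricWitnessObstructionQP → FixedWitnessObstructionQP (take n₀' =
max(n₀, 3); ToricFixedPoints turns a witness (P•, J) into a toric one with the same J; H₀-stability
and J ⊆ pp^⊥ carry over verbatim). Records the split as a statement; once proved, crux 2 is
`derived` from cruxes 3–4 in the cone of `closes`. [difficulty: provable-now]
[Summits/ValiantsHypothesis/ValiantsHypothesis/Theses/BorderApolarity.lean]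
DROPPED 2026-08-16 (route-repair, unused-crux): BorderDcPerThreeSix (stmt-ValiantsHypothesis-5780,
X₀₀²·per_3 ∉ Δ(det_5), i.e. bdc(per_3) ≥ 6) — a single finite instance cannot feed the asymptotic
hypothesis FixedWitnessObstructionQP (∀ c ∃ n₀ ∀ n ≥ n₀ …) of the deciding theorem, so no honest
glue item exists; it was the test-bed of the certificate, not a load-bearing step (its refutation
was already declared 're-ranks, not closes'). Its disproof file, numerics and 7 crux ideas stay on
the item and under Cruxes/BorderDcPerThreeSix/ as the record; the (3,4)/(3,5) instances remain the
CHEAPEST FALSIFIER computation of cruxes 3–4 below, not an item.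
#9 BorelFixedBorderApolarity (support) — card X1 (known mathematics, unformalised): for 3 ≤ n ≤ m,
if X₀₀^(m−n) per_n ∈ Δ(det_m) then a witness as in crux 2 EXISTS — Zariski = Euclidean closure
(orbitClosure_eq_euclidean_closure_complex_holds) gives g_t·det_m → pp; compactness of the
Grassmannians gives a convergent subsequence of (Ann_k(g_t det_m))_k whose limit lies in pp^⊥ by
continuity of the pairing (BB Thm 1, necessity half); the set of such limits is a closed
Stab(pp)-stable subvariety of the projective variety Z_det, and H₀(n,m) is a connected (kernel of a
primitive character × unipotent) solvable (triangular) subgroup of Stab(pp), so Borel's fixed point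
theorem yields an H₀-fixed limit (BB Thm 31, Fixed Ideal Theorem). Operators transform by D ↦ D∘Mᵀ
because D·(M·f) = M·((D∘Mᵀ)·f). [difficulty: XL] [BuczynskaBuczynski2021, Borel1991,
MillerSturmfels2005, LandsbergGCT2017, MulmuleySohoni2001]
#9 WitnessToMembership (support) — converse (sufficiency half of border apolarity, elementary): for
3 ≤ n ≤ m a witness (P•, J) as in crux 2 forces X₀₀^(m−n) per_n ∈ Δ(det_m) — J_m is a limit of the
hyperplanes Ann_m(P_t) and lies in the hyperplane Ann_m(pp), so [P_t] → [pp] by the perfect pairing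
ℂ[∂]_m × ℂ[x]_m → ℂ, hence pp is a Euclidean, hence Zariski, limit of GL·det_m. Records that crux 2
is pointwise no weaker and no stronger than non-membership: the route's content is the normal form,
not a weakening. [difficulty: M] [BuczynskaBuczynski2021, LandsbergGCT2017, MulmuleySohoni2001]
#9 GctBridge (support) — the quasi-polynomial Mulmuley–Sohoni thesis (GctThesis of route GCTMult,
inlined) implies VP_ℂ ≠ VNP_ℂ; provable now by chaining the in-tree theorems gct_assembly
(Theorems/GCTMultAssembly.lean), paddedPerPoly_mem_orbitClosure_detPoly_of_hasDetRepr_holds,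
hasDetRepr_determinantalComplexity_holds, HasDetRepr.mono_holds,
isQPBounded_determinantalComplexity_of_isVPFamily_holds, mem_VP_ofFintype_iff_holds,
perFamily_mem_VNP_holds and Hub.valiantsHypothesis_of_not_isVPFamily_per. [difficulty: provable-now]
[MulmuleySohoni2001, BurgisserLandsbergManivelWeyman2011,
Summits/ValiantsHypothesis/ValiantsHypothesis/Theorems/GCTMultAssembly.lean,
Summits/ValiantsHypothesis/ValiantsHypothesis/Theorems/HubHub.lean]

TWO-LAYER PLAN. FILED 2026-08-16: FixedWitnessObstructionQP ⇐ ToricFixedPoints →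
ToricWitnessObstructionQP → FixedWitnessObstructionQP (glue = support ToricReduction, pure logic,
also inlined in `closes`, whose hypotheses are now the two children + BorelFixedBorderApolarity +
GctBridge; items 14753/14757 added by `workitem add`, structurally top-level, logically the children
of crux 2; crux 2 stays rank 2 and directly claimable — a direct proof of it re-glues `closes` back
to (X)(Borel)(Bridge) in one edit). Foreseen next (tenure, after the 5778 lead's closing report):
ToricWitnessObstructionQP ⇐ ToricDeborderQP (= the lead's registered stub_weightBoundMax: an
extremal toric representation pp = u·in_w(g·det_m) at size m trades for weights ≤ 2^polylog m) ∧
DcPerEventuallySuperQP (eventual super-qp dc(per_n); external, VH-strength on its own — file only as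
a declared shared/conditional item) via the landed socleMax/interp/invRepr/unpad/deborder theorems.
BorelFixedBorderApolarity ⇐ SequentialBorderApolarity (compactness + continuity, no groups) →
BorelOnLimitSet (fixed point of H₀ on the closed H₀-stable limit set) → BorelFixedBorderApolarity. k
≤ 3, depth 1 each.

KILL CRITERIA. WitnessToMembership + BorelFixedBorderApolarity make crux 2 pointwise equivalent to
X₀₀^(m−n) per_n ∉ Δ(det_m): a theorem "border-dc(per_n) ≤ 2^((log n)^c) infinitely often"
(equivalently a refutation of GCTMult's GctThesis) refutes FixedWitnessObstructionQP — close
`refuted:FixedWitnessObstructionQP` (GCTMult and IntegralGCT die with it; VH survives only via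
non-border routes). A refutation of ToricFixedPoints (an H₀-fixed limit ideal of det_m^⊥ not
reachable by one 1-PSG) does not close the route but removes its engine: pivot to a two-step
(iterated degeneration) normal form or restrict crux 2 to the End(W)·det_m part and pair it with a
separate dc-vs-border-dc crux. A refutation of ToricWitnessObstructionQP refutes
FixedWitnessObstructionQP (toric witnesses are witnesses) and hence the route exactly as above.
(X₀₀² per_3 ∈ Δ(det_5), formerly item BorderDcPerThreeSix, would be a discovery — first permanent
with border-dc < dc — and informs cruxes 3–4 but is no longer an item.) A refutation of
BorelFixedBorderApolarity can only come from the Lean rendering (limits, H₀, operator action);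
repair by restatement, the mathematics (BB Thm 31 + Borel) is not in doubt. GctThesis proved
elsewhere (GCTMult flip) moots the route.

NOT DECOMPOSED YET. Deliberately not filed: the Lean infrastructure the support item needs
(Grassmannian compactness, Borel fixed point theorem, Chevalley constructibility in a product of
Grassmannians — definition requests below); the structure of det_m^⊥ and per_m^⊥ (generated by
explicit quadrics, Shafiei2015 — enters as a cite fact when crux 3/4 work starts); the
degree-by-degree combinatorics of H₀-stable subspaces (contingency-table gradings on the Y-block,
strongly-stable-type closure towards the z-variables); the iterated-degeneration refinement of
ToricFixedPoints; any m = n (unpadded) special case. These are layer-2 children once a crux moves.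

CHEAPEST FALSIFIER. Run the certificate where the answer is KNOWN: (n,m) = (3,4), X₀₀·per_3 ∉
Δ(det_4) by LMR13 (4 < 9/2). Enumerate the H₀(3,4)-fixed points of Z_det_4 (16 variables; det_4^⊥ is
generated by 2×2 permanents/monomial quadrics, Shafiei2015; CHL-style fixed-ideal search,
ConnerHarperLandsberg2023 §§2–4) and check their degree-4 socles against Ann_4(X₀₀ per_3). If the
fixed-point set cannot be organised even at m = 4, the line is dead in practice; if some fixed point
is visibly not a one-parameter limit, crux 3 is refuted at once. Second, m = 3: both boundary
components of Δ(det_3) (HuttenhainLairez2016; LandsbergGCT2017 Thm 6.7.2.5) are one-parameter limits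
of translates (P₁ ∈ End·det_3, P₂ = lim det(A_skew + tS)), consistent with crux 3 at the level of
socles — a Macaulay2 check of the corresponding limit IDEALS is the cheapest ideal-level test. Not
run here (no CAS on the hub; one-shot planner unit).

NUMBERS. border-dc(per_m) ≥ m²/2 (LandsbergManivelRessayre2013 = LandsbergGCT2017 Thm 6.5.2.3), and
these equations provably stop there (cones have degenerate duals, ibid.); dc(per_3) = 7, dc(per_4) ≥
9 (AlperBogartVelasco2017 = LandsbergGCT2017 Cor 6.3.4.8); so 5 ≤ border-dc(per_3) ≤ 7 is the first
open value (formerly item BorderDcPerThreeSix); dc(per_n) ≤ 2^n − 1 (Grenet2011); ∂Δ(det_3) has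
exactly 2 components, one outside End(W)·det_3 (HuttenhainLairez2016); border-dc(P_Λ) = n < 6 ≤
dc(P_Λ) at n = 3 (LandsbergGCT2017 Prop 6.7.2.2, Thm 6.7.3.1); Ann_1(det_m) = 0 and det_m^⊥, per_m^⊥
are generated in degree 2 with equal Hilbert functions (Shafiei2015); codim of J_k in ℂ[∂]_k is
C(m,k)² for every J ∈ Z_det_m; no occurrence obstructions once m ≥ n^25
(BurgisserIkenmeyerPanova2019) — irrelevant to this certificate but fixes the regime where only
quantitative/structural information can work. Items at open: 7 (3 cruxes, 3 support, 1 assembly);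
after the 2026-08-16 unused-crux repair: 8 active (3 cruxes #2–#4, 4 support incl. glue
ToricReduction, 1 assembly), BorderDcPerThreeSix dropped.

DEFINITION REQUESTS. D1 `apolarAction` / `annihilatorIdeal`
(Literature/Computability/AlgebraicComplexity or Literature/Algebra): the ℂ[∂]-module structure D·f
on MvPolynomial σ ℂ (the inline `act` of the statements: ∂^e x^d = Π descFactorial(d_i,e_i) x^(d−e))
and f^⊥; D2 `borderApolarLimit` (points of Z_P written sequentially: degree-wise Kuratowski limits
of Ann_k(P_t) along P_t ∈ GL·P, with the lemma that they are ideals with the Hilbert function of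
P^⊥); D3 (later) Borel fixed point theorem as a named Literature fact over a projective variety with
an algebraic action. Cite facts wanted: BuczynskaBuczynski2021 Thm 31 (Fixed Ideal Theorem) and Thm
1; Shafiei2015 main theorems (generators of det^⊥, per^⊥). Filed after open against the support
item.

Novelty: Searches (2026-08-15): `lit search "border apolarity" --source zbmath` (15 hits, 2013–2026: all
secant/cactus/VSP/border-rank settings — 1910.01944, 1911.07981, 2310.19625, 2601.19558,
2210.13579-adjacent, none on orbit closures); `lit search "apolarity determinant permanent generic
matrix" --source zbmath` (1: Shafiei2015); `lit search "boundary orbit closure determinant" --source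
zbmath` (4: Kumar 2013 doi:10.4171/cmh/302, HuttenhainLairez2016); `lit search "limits of saturated
ideals" --source zbmath` (JelisiejewMandziuk2025, Mańdziuk arXiv:2306.08104, Landsberg survey
arXiv:2108.06263); `lit search --hybrid "fixed ideal theorem border apolarity Borel subgroup
multigraded Hilbert scheme" --source local` (LandsbergGCT2017 pp.130–132, 282: normal form lemma
5.4.3.6 and apolar ideal §10.1.2; MillerSturmfels2005); `lit galaxy search "border apolarity" --star
all` (2 pdf hits: Landsberg, Rend. Trieste 54 (2022) survey; Mańdziuk 2306.08104; 0 panama, 0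
crabby); `lit frontier ValiantsHypothesis --since 2021` (30 rows; nearest arXiv:2606.13628
near-quadratic BORDER dc of power sums via conormal specialization — different object); `lit read
arxiv:1910.01944` (Thm 1, Thm 31, Cor 33 verified on pp. 4, 14), `lit read arxiv:1512.02437`;
OpenAlex/S2/arXiv APIs rate-limited (429) at search time; `ledger negatives --problem
ValiantsHypothesis` = 0.
Nearest prior art found: BuczynskaBuczynski2021 (arXiv:1910.01944) Thm 31 Fixed Ideal Theorem and
Thm 1 — for SECANT varieties (Slip_r,X); Con  [refs: 10.4171/cmh/302, 2306.08104, 2108.06263, 2606.13628, 1910.01944, 1512.02437, 1911.07981, doi:10.4171/cmh/302, arxiv:1910.01944, arxiv:1512.02437, Shafiei2015, HuttenhainLairez2016, JelisiejewMandziuk2025, LandsbergGCT2017, MillerSturmfels2005, BuczynskaBuczynski2021, ConnerHarperLandsberg2023, HuangMichalekVentura2020]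

Barriers (technique_class: border-apolarity, Borel-fixed-ideals, orbit-closure): - technique_class: border-apolarity, Borel-fixed-ideals, orbit-closure
- Literature.Barriers.ValiantsHypothesis.PartialDerivativesDetPerm: evaded in letter — the barrier
binds methods that are functions of the flattening-RANK profile (equal for per and det); the
certificate uses the kernels Ann_k as subspaces, their limits in the Grassmannian, the ideal
structure across degrees and H₀-fixedness, i.e. exactly the entry's recorded evasion "use the maps,
not their ranks (kernels, ideals)". The same answer covers its shifted-partials strengthening (ELSW
2018 no-go, ShiftedPartialDerivatives.lean: a sub-additive rank measure on x^β∂^α-images):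
non-existence of a FIXED LIMIT IDEAL is not a rank inequality and is not monotone under restriction;
honest caveat: degree by degree, "some limit of Ann_k(g_t det) sits inside Ann_k(pp)" is implied by
membership just as rank semicontinuity is, so all extra power must come from coupling the degrees
(ideal property) and from H₀ — unproven that it suffices; the bet is that this finer data survives
padding.
- Literature.Barriers.ValiantsHypothesis.GCTUsefulModules: does not apply formally (no separating
modules), but its pathology is this route's main risk: pp is a cone, pp^⊥ contains every ∂_z and
∂_ℓ^(m−n+1), so containment J ⊆ pp^⊥ is cheap in most of ℂ[∂]; the bet is that H₀'s unipotent part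
(lower every ℓ,Y-derivative into the z-derivatives) turns the padding variables into a normal-form
RESOURCE; confronted head-on in FixedWitnessObstructi

Novelty grade: new-combination — route-review (refuter 539a64a6): KEEP. 7/7 decls elaborate (W2.lean rc0). Encoding audited: act D f = ∂^e x^d (descFactorial, 0 if e≰d) ✓; linSubst A: X_i↦Σ_j A_{ji}X_j so D·(M·f)=0 ⇔ (linSubst Mᵀ D)·f=0, Ann(M·f)=linSubst((Mᵀ)⁻¹)Ann f, hence 'H₀-fixed' ⇔ linSubst(Mᵀ)J=J ∀M∈H₀ ⇔ W4 as typed (H₀ clos (refuter refuter-rreview-route-AtomisticToContinu-539a64a6-0, 2026-08-15T13:57:43Z; prior: arXiv:1910.01944, arXiv:2309.15816, LandsbergManivelRessayre2013, MulmuleySohoni2001)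

History (route lifecycle, newest last):
- 2026-08-16T06:33:42Z · rev 2: dropped BorderDcPerThreeSix — route-repair (unused-crux): 1 glued / 1 dropped. GLUED ToricFixedPoints: added crux ToricWitnessObstructionQP (stmt-ValiantsHypothesis-14753, rank 4: thesis X r (planner-rrepair-ValiantsHypothesis-BorderApola-03b04f15-0)

sub-problem: ValiantsHypothesis · status: open · opened planner-plancard-ValiantsHypothesis-ValiantsH-aea0e688-0 2026-08-15T11:42:27Z · rev 3 · ledger route-ValiantsHypothesis-BorderApolarity
GENERATED by the gate from the ledger (D-0016/17). Provers cite these decls: `theorem foo : Summit.ValiantsHypothesis.ValiantsHypothesis.Theses.BorderApolarity.<Decl> := …` in Summits/ValiantsHypothesis/ValiantsHypothesis/Theorems/<Name>.lean.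
-/

namespace Summit.ValiantsHypothesis.ValiantsHypothesis.Theses.BorderApolarity

open scoped BigOperators Topology Manifold Classical MeasureTheory ProbabilityTheory Matrix InnerProductSpace ComplexConjugate ContinuousMap
open Filter Set Function TopologicalSpace MeasureTheory

attribute [summit_statement] _root_.ValiantsHypothesis

open Literature.PNP

/-- item stmt-ValiantsHypothesis-5778 · crux · rank 2 · open · by planner
why it might fail: Pointwise equivalent to pp ∉ Δ(det_m) (support items): false if border-dc(per_n) ≤ 2^polylog n, which nothing excludes (m²/2 ≤ bdc ≤ 2^n−1); and H₀-fixed points of Z_det_m may be as wild as ∂Δ(det_m) itself (padded forms are cones, LandsbergGCT2017 §6.5.2).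
sources: BuczynskaBuczynski2021, ConnerHarperLandsberg2023, LandsbergManivelRessayre2013, LandsbergGCT2017, Grenet2011, MulmuleySohoni2001
[crux] card X3 — for every c there is n₀ such that for n ≥ n₀ and n ≤ m ≤ 2^((log₂ n + c)^c) no
H₀(n,m)-stable Kuratowski limit J = lim Ann(P_t) (P_t ∈ GL·det_m) has J_k ⊆ Ann_k(X₀₀^(m−n) per_n)
for all k ≤ m (the thesis X). [difficulty: open-problem] -/
@[route_item "route-ValiantsHypothesis-BorderApolarity", crux]
def FixedWitnessObstructionQP : Prop :=
  ∀ c : ℕ, ∃ n₀ : ℕ, ∀ n ≥ n₀, ∀ (m : ℕ) [NeZero m], n ≤ m → m ≤ 2 ^ ((Nat.log 2 n + c) ^ c) → let act := fun (D f : MvPolynomial (Fin m × Fin m) ℂ) => ∑ e ∈ D.support, ∑ d ∈ f.support, MvPolynomial.monomial (d - e) (MvPolynomial.coeff e D * MvPolynomial.coeff d f * ∏ i ∈ e.support, (Nat.descFactorial (d i) (e i) : ℂ)); let rk := fun (p : Fin m × Fin m) => (if (m - n ≤ (p.1 : ℕ) ∧ m - n ≤ (p.2 : ℕ)) ∨ p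 = (0, 0) then 0 else m * m) + ((p.1 : ℕ) * m + (p.2 : ℕ)); ¬ ∃ (P : ℕ → MvPolynomial (Fin m × Fin m) ℂ) (J : ℕ → Set (MvPolynomial (Fin m × Fin m) ℂ)), (∀ t : ℕ, P t ∈ Literature.Computability.AlgebraicComplexity.glOrbit (Fin m × Fin m) ℂ (Literature.Computability.AlgebraicComplexity.detPoly (Fin m) ℂ)) ∧ (∀ k ≤ m, ∀ D ∈ J k, ∃ Ds : ℕ → MvPolynomial (Fin m × Fin m) ℂ, (∀ t, (Ds t).IsHomogeneous k ∧ act (Ds t) (P t) = 0) ∧ Filter.Tendsto (fun t => Literature.Computability.AlgebraicComplexity.coeffVec (Ds t)) Filter.atTop (nhds (Literature.Computability.AlgebraicComplexity.coeffVec D))) ∧ (∀ k ≤ m, ∀ (D : MvPolynomial (Fin m × Fin m) ℂ) (φ : ℕ → ℕ) (Ds : ℕ → MvPolynomial (Fin m × Fin m) ℂ), StrictMono φ → (∀ t, (Ds t).IsHomogeneous k ∧ act (Ds t) (P (φ t)) = 0) → Filter.Tendsto (fun t => Literature.Computability.AlgebraicComplexity.coeffVec (Ds t)) Filter.atTop (nhds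 (Literature.Computability.AlgebraicComplexity.coeffVec D)) → D ∈ J k) ∧ (∀ A : Matrix.GeneralLinearGroup (Fin m × Fin m) ℂ, let M : Matrix (Fin m × Fin m) (Fin m × Fin m) ℂ := A; (∀ i j : Fin m × Fin m, M j i ≠ 0 → rk j ≤ rk i) → (∀ i j : Fin m × Fin m, ((m - n ≤ (i.1 : ℕ) ∧ m - n ≤ (i.2 : ℕ)) ∨ i = (0, 0)) → j ≠ i → M j i = 0) → (∀ i k j l : Fin m, m - n ≤ (i : ℕ) → m - n ≤ (k : ℕ) → m - n ≤ (j : ℕ) → m - n ≤ (l : ℕ) → M (i, j) (i, j) * M (k, l) (k, l) = M (i, l) (i, l) * M (k, j) (k, j)) → M (0, 0) (0, 0) ^ (m - n) * ∏ i ∈ Finset.univ.filter (fun i : Fin m => m - n ≤ (i : ℕ)), M (i, i) (i, i) = 1 → ∀ k ≤ m, ∀ D ∈ J k, Literature.Computability.AlgebraicComplexity.linSubst (Fin m × Fin m) ℂ Mᵀ D ∈ J k) ∧ (∀ k ≤ m, ∀ D ∈ J k, act D (Literature.Computability.AlgebraicComplexity.paddedPerPoly ℂ n m) = 0)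

/-- item stmt-ValiantsHypothesis-5779 · crux · rank 3 · open · by planner
why it might fail: Orbit closures contain points reached only by iterated degenerations (G((t)) = G[[t]]·T·G[[t]] does not reduce to one 1-PSG of a fixed translate) and non-saturated limit ideals abound (JelisiejewMandziuk2025); one H₀-fixed such point of Z_det_m, maybe already at m = 3 or 4, refutes it.
sources: HuttenhainLairez2016, LandsbergManivelRessayre2013, JelisiejewMandziuk2025, HuangMichalekVentura2020, Green1998GenericInitialIdeals, LandsbergGCT2017
[crux] card X2 (structure of fixed points) — for 3 ≤ n ≤ m, every H₀(n,m)-stable point J of Z_det_m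
(Kuratowski limit of Ann(P_t), P_t ∈ GL·det_m) is a one-parameter-subgroup limit of an interior
point: J = lim_t Ann(u·diag((t+2)^w)·g·det_m) for some u, g ∈ GL_(m²) and integer weights w, i.e. a
translate of a Gröbner degeneration in_w((g·det_m)^⊥); this makes the fixed-point set of crux 2 an
explicitly parametrised (toric) family containing End(W)·det_m and the P_Λ-type boundary components.
[difficulty: L] -/
@[route_item "route-ValiantsHypothesis-BorderApolarity", crux]
def ToricFixedPoints : Prop :=
  ∀ (n m : ℕ) [NeZero m], 3 ≤ n → n ≤ m → let act := fun (D f : MvPolynomial (Fin m × Fin m) ℂ) => ∑ e ∈ D.support, ∑ d ∈ f.support, MvPolynomial.monomial (d - e) (MvPolynomial.coeff e D * MvPolynomial.coeff d f * ∏ i ∈ e.support, (Nat.descFactorial (d i) (e i) : ℂ)); let rk := fun (p : Fin m × Fin m) => (if (m - n ≤ (p.1 : ℕ) ∧ m - n ≤ (p.2 : ℕ)) ∨ p = (0, 0) then 0 else m * m) + ((p.1 : ℕ) * m + (p.2 : ℕ)); ∀ (P : ℕ → MvPolynomial (Fin m × Fin m) ℂ) (J : ℕ → Set (MvPolynomial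 (Fin m × Fin m) ℂ)), (∀ t : ℕ, P t ∈ Literature.Computability.AlgebraicComplexity.glOrbit (Fin m × Fin m) ℂ (Literature.Computability.AlgebraicComplexity.detPoly (Fin m) ℂ)) → (∀ k ≤ m, ∀ D ∈ J k, ∃ Ds : ℕ → MvPolynomial (Fin m × Fin m) ℂ, (∀ t, (Ds t).IsHomogeneous k ∧ act (Ds t) (P t) = 0) ∧ Filter.Tendsto (fun t => Literature.Computability.AlgebraicComplexity.coeffVec (Ds t)) Filter.atTop (nhds (Literature.Computability.AlgebraicComplexity.coeffVec D))) ∧ (∀ k ≤ m, ∀ (D : MvPolynomial (Fin m × Fin m) ℂ) (φ : ℕ → ℕ) (Ds : ℕ → MvPolynomial (Fin m × Fin m) ℂ), StrictMono φ → (∀ t, (Ds t).IsHomogeneous k ∧ act (Ds t) (P (φ t)) = 0) → Filter.Tendsto (fun t => Literature.Computability.AlgebraicComplexity.coeffVec (Ds t)) Filter.atTop (nhds (Literature.Computability.AlgebraicComplexity.coeffVec D)) → D ∈ J k) → (∀ A : Matrix.GeneralLinearGroup (Fin m × Fin m) ℂ, let M : Matrix (Fin m × Fin m) (Fin m × Fin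 m) ℂ := A; (∀ i j : Fin m × Fin m, M j i ≠ 0 → rk j ≤ rk i) → (∀ i j : Fin m × Fin m, ((m - n ≤ (i.1 : ℕ) ∧ m - n ≤ (i.2 : ℕ)) ∨ i = (0, 0)) → j ≠ i → M j i = 0) → (∀ i k j l : Fin m, m - n ≤ (i : ℕ) → m - n ≤ (k : ℕ) → m - n ≤ (j : ℕ) → m - n ≤ (l : ℕ) → M (i, j) (i, j) * M (k, l) (k, l) = M (i, l) (i, l) * M (k, j) (k, j)) → M (0, 0) (0, 0) ^ (m - n) * ∏ i ∈ Finset.univ.filter (fun i : Fin m => m - n ≤ (i : ℕ)), M (i, i) (i, i) = 1 → ∀ k ≤ m, ∀ D ∈ J k, Literature.Computability.AlgebraicComplexity.linSubst (Fin m × Fin m) ℂ Mᵀ D ∈ J k) → ∃ (u g : Matrix.GeneralLinearGroup (Fin m × Fin m) ℂ) (w : Fin m × Fin m → ℤ), let Q : ℕ → MvPolynomial (Fin m × Fin m) ℂ := fun t => Literature.Computability.AlgebraicComplexity.linSubst (Fin m × Fin m) ℂ (u : Matrix (Fin m × Fin m) (Fin m × Fin m) ℂ) (Literature.Computability.AlgebraicComplexity.linSubst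 (Fin m × Fin m) ℂ (Matrix.diagonal fun i : Fin m × Fin m => ((t : ℂ) + 2) ^ (w i)) (Literature.Computability.AlgebraicComplexity.linSubst (Fin m × Fin m) ℂ (g : Matrix (Fin m × Fin m) (Fin m × Fin m) ℂ) (Literature.Computability.AlgebraicComplexity.detPoly (Fin m) ℂ))); (∀ k ≤ m, ∀ D ∈ J k, ∃ Ds : ℕ → MvPolynomial (Fin m × Fin m) ℂ, (∀ t, (Ds t).IsHomogeneous k ∧ act (Ds t) (Q t) = 0) ∧ Filter.Tendsto (fun t => Literature.Computability.AlgebraicComplexity.coeffVec (Ds t)) Filter.atTop (nhds (Literature.Computability.AlgebraicComplexity.coeffVec D))) ∧ (∀ k ≤ m, ∀ (D : MvPolynomial (Fin m × Fin m) ℂ) (φ : ℕ → ℕ) (Ds : ℕ → MvPolynomial (Fin m × Fin m) ℂ), StrictMono φ → (∀ t, (Ds t).IsHomogeneous k ∧ act (Ds t) (Q (φ t)) = 0) → Filter.Tendsto (fun t => Literature.Computability.AlgebraicComplexity.coeffVec (Ds t)) Filter.atTop (nhds (Literature.Computability.AlgebraicComplexity.coeffVec D)) → D ∈ J k)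

/-- item stmt-ValiantsHypothesis-14753 · crux · rank 4 · open · by planner
why it might fail: Sandwiched: GctThesis ⇒ FixedWitnessObstructionQP ⇒ this; false iff padded permanents are extremal initial forms in_w(g·det_m) at m ≤ 2^polylog n infinitely often — Grenet's 2^n−1 ABP is already a 0/1-weight toric representation and nothing known bounds the weight/size trade-off.
sources: MulmuleySohoni2001, Grenet2011, Green1998GenericInitialIdeals, BuczynskaBuczynski2021, LandsbergManivelRessayre2013, LandsbergGCT2017
[crux] (rank 4; thesis X in TORIC NORMAL FORM — child of FixedWitnessObstructionQP together with
ToricFixedPoints, glue = support item ToricReduction) for every c there is n₀ such that for n ≥ n₀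
and n ≤ m ≤ 2^((log₂ n + c)^c) there are NO u, g ∈ GL_(m²), integer weights w : [m]×[m] → ℤ and J =
(J_k)_(k ≤ m) with: J the degree-wise Kuratowski limit of the annihilator spaces Ann_k(Q_t) along
the toric curve Q_t := u·diag((t+2)^w)·g·det_m (a translate of the torus/Gröbner degeneration
in_w((g·det_m)^⊥)), J stable under H₀(n,m) ⊆ Stab(pp) (same encoding as FixedWitnessObstructionQP),
and J_k ⊆ Ann_k(pp) for all k ≤ m, pp := X₀₀^(m−n) per_n. Sandwich: FixedWitnessObstructionQP ⇒ this
(toric curves lie in GL·det_m: landed Theorems/ToricFixedPoints/Negative/WithoutUpperLimitFalse.lean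
`toricCurve_mem_glOrbit`), and ToricFixedPoints ∧ this ⇒ FixedWitnessObstructionQP (pure logic,
ToricReduction). By the landed socle step
(Theorems/BorderApolarityFixedWitnessObstructionQPSocleMax.lean, p83124) a toric witness forces pp =
u′·in_w′(g′·det_m) as an EXTREMAL weighted component, so this reads: no extremal toric
(initial-form) representation of the padded permanent at quasi-polynomial size; the -/
@[route_item "route-ValiantsHypothesis-BorderApolarity", crux]
def ToricWitnessObstructionQP : Prop :=
  ∀ c : ℕ, ∃ n₀ : ℕ, ∀ n ≥ n₀, ∀ (m : ℕ) [NeZero m], n ≤ m → m ≤ 2 ^ ((Nat.log 2 n + c) ^ c) → let act := fun (D f : MvPolynomial (Fin m × Fin m) ℂ) => ∑ e ∈ D.support, ∑ d ∈ f.support, MvPolynomial.monomial (d - e) (MvPolynomial.coeff e D * MvPolynomial.coeff d f * ∏ i ∈ e.support, (Nat.descFactorial (d i) (e i) : ℂ)); let rk := fun (p : Fin m × Fin m) => (if (m - n ≤ (p.1 : ℕ) ∧ m - n ≤ (p.2 : ℕ)) ∨ p = (0, 0) then 0 else m * m) + ((p.1 : ℕ) * m + (p.2 : ℕ)); ¬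 ∃ (u g : Matrix.GeneralLinearGroup (Fin m × Fin m) ℂ) (w : Fin m × Fin m → ℤ) (J : ℕ → Set (MvPolynomial (Fin m × Fin m) ℂ)), let Q : ℕ → MvPolynomial (Fin m × Fin m) ℂ := fun t => Literature.Computability.AlgebraicComplexity.linSubst (Fin m × Fin m) ℂ (u : Matrix (Fin m × Fin m) (Fin m × Fin m) ℂ) (Literature.Computability.AlgebraicComplexity.linSubst (Fin m × Fin m) ℂ (Matrix.diagonal fun i : Fin m × Fin m => ((t : ℂ) + 2) ^ (w i)) (Literature.Computability.AlgebraicComplexity.linSubst (Fin m × Fin m) ℂ (g : Matrix (Fin m × Fin m) (Fin m × Fin m) ℂ) (Literature.Computability.AlgebraicComplexity.detPoly (Fin m) ℂ))); (∀ k ≤ m, ∀ D ∈ J k, ∃ Ds : ℕ → MvPolynomial (Fin m × Fin m) ℂ, (∀ t, (Ds t).IsHomogeneous k ∧ act (Ds t) (Q t) = 0) ∧ Filter.Tendsto (fun t => Literature.Computability.AlgebraicComplexity.coeffVec (Ds t)) Filter.atTop (nhds (Literature.Computability.AlgebraicComplexity.coeffVec D))) ∧ (∀ k ≤ m, ∀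 (D : MvPolynomial (Fin m × Fin m) ℂ) (φ : ℕ → ℕ) (Ds : ℕ → MvPolynomial (Fin m × Fin m) ℂ), StrictMono φ → (∀ t, (Ds t).IsHomogeneous k ∧ act (Ds t) (Q (φ t)) = 0) → Filter.Tendsto (fun t => Literature.Computability.AlgebraicComplexity.coeffVec (Ds t)) Filter.atTop (nhds (Literature.Computability.AlgebraicComplexity.coeffVec D)) → D ∈ J k) ∧ (∀ A : Matrix.GeneralLinearGroup (Fin m × Fin m) ℂ, let M : Matrix (Fin m × Fin m) (Fin m × Fin m) ℂ := A; (∀ i j : Fin m × Fin m, M j i ≠ 0 → rk j ≤ rk i) → (∀ i j : Fin m × Fin m, ((m - n ≤ (i.1 : ℕ) ∧ m - n ≤ (i.2 : ℕ)) ∨ i = (0, 0)) → j ≠ i → M j i = 0) → (∀ i k j l : Fin m, m - n ≤ (i : ℕ) → m - n ≤ (k : ℕ) → m - n ≤ (j : ℕ) → m - n ≤ (l : ℕ) → M (i, j) (i, j) * M (k, l) (k, l) = M (i, l) (i, l) * M (k, j) (k, j)) → M (0, 0) (0, 0) ^ (m - n) * ∏ i ∈ Finset.univ.filter (fun i : Fin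 m => m - n ≤ (i : ℕ)), M (i, i) (i, i) = 1 → ∀ k ≤ m, ∀ D ∈ J k, Literature.Computability.AlgebraicComplexity.linSubst (Fin m × Fin m) ℂ Mᵀ D ∈ J k) ∧ (∀ k ≤ m, ∀ D ∈ J k, act D (Literature.Computability.AlgebraicComplexity.paddedPerPoly ℂ n m) = 0)

/-- item stmt-ValiantsHypothesis-0983 · support · rank 9 · closed · proved by Summit.ValiantsHypothesis.ValiantsHypothesis.Theorems.BorderApolarityGctBridge.gctBridge_route_proof @ b072793f699b (prover) · by planner
sources: MulmuleySohoni2001, BurgisserLandsbergManivelWeyman2011, Summits/ValiantsHypothesis/ValiantsHypothesis/Theorems/GCTMultAssembly.lean, Summits/ValiantsHypothesis/ValiantsHypothesis/Theorems/HubHub.lean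
[support] Bookkeeping, provable now from PROVED cone facts: the qp Mulmuley-Sohoni thesis (=
GCTMult.GctThesis, stmt-0323) implies ValiantsHypothesis, by composing
Literature.CplxAlg.gct_assembly (Theorems/GCTMultAssembly.lean) with
paddedPerPoly_mem_orbitClosure_detPoly_of_hasDetRepr_holds, hasDetRepr_determinantalComplexity
(discharged), HasDetRepr.mono, isQPBounded_determinantalComplexity_of_isVPFamily_holds,
mem_VP_ofFintype_iff_holds, perFamily_mem_VNP_holds and
Summit.ValiantsHypothesis.Hub.valiantsHypothesis_of_not_isVPFamily_per (Theorems/HubHub.lean).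
Shared glue usable by GCTMult as well. -/
@[route_item "route-ValiantsHypothesis-BorderApolarity", crux]
def GctBridge : Prop :=
  (∀ c : ℕ, ∃ n₀ : ℕ, ∀ n ≥ n₀, ∀ (m : ℕ) [NeZero m], n ≤ m → m ≤ 2 ^ ((Nat.log 2 n + c) ^ c) → Literature.Computability.AlgebraicComplexity.paddedPerPoly ℂ n m ∉ Literature.Computability.AlgebraicComplexity.orbitClosure (Literature.Computability.AlgebraicComplexity.detPoly (Fin m) ℂ)) → ValiantsHypothesis

/-- item stmt-ValiantsHypothesis-14757 · support · rank 9 · closed · proved by Summit.ValiantsHypothesis.ValiantsHypothesis.Theorems.toricReduction_proof @ b55d6777201f (prover) · by planner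
sources: Summits/ValiantsHypothesis/ValiantsHypothesis/Theses/BorderApolarity.lean
[support] GLUE (pure logic, provable now — scratch proof `toricReduction_scratch` in the planner
folder Sketch.lean, lean rc 0, axioms {propext, Classical.choice, Quot.sound}): ToricFixedPoints →
ToricWitnessObstructionQP → FixedWitnessObstructionQP. Given c take n₀' = max(n₀(c), 3); for n ≥
n₀', n ≤ m ≤ 2^((log₂ n + c)^c) a witness (P•, J) of FixedWitnessObstructionQP is turned by
ToricFixedPoints (needs 3 ≤ n ≤ m; inputs W1 orbit, W2∧W3 Kuratowski limit, W4 H₀-stability) into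
(u, g, w) with J the Kuratowski limit along the toric curve Q_t = u·diag((t+2)^w)·g·det_m;
H₀-stability and J_k ⊆ Ann_k(pp) are properties of J and carry over verbatim, contradicting
ToricWitnessObstructionQP. This is the glued split FixedWitnessObstructionQP ⇐ ToricFixedPoints ∧
ToricWitnessObstructionQP foreseen in the route's TWO-LAYER PLAN; it puts crux ToricFixedPoints (the
route's structural engine) into the cone of the deciding theorem `closes`. The `let act/rk` bindings
of the three decls are syntactically identical, so after `simp only []` the proof is
intro/obtain/exact. [difficulty: provable-now] sources:
Summits/ValiantsHypothesis/ValiantsHypothesis/Theses/BorderApolarity.lean, BuczynskaBuczynski -/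
@[route_item "route-ValiantsHypothesis-BorderApolarity"]
def ToricReduction : Prop :=
  ToricFixedPoints → ToricWitnessObstructionQP → FixedWitnessObstructionQP

/-- item stmt-ValiantsHypothesis-5781 · support · rank 9 · closed · proved by Summit.ValiantsHypothesis.ValiantsHypothesis.Theorems.BorderApolarityBorelFixedBorderApolarity.BorelFixedBorderApolarity_proof (prover) · by planner
sources: BuczynskaBuczynski2021, Borel1991, MillerSturmfels2005, LandsbergGCT2017, MulmuleySohoni2001
[support] card X1 (known mathematics, unformalised): for 3 ≤ n ≤ m, if X₀₀^(m−n) per_n ∈ Δ(det_m)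
then a witness as in crux 2 EXISTS — Zariski = Euclidean closure
(orbitClosure_eq_euclidean_closure_complex_holds) gives g_t·det_m → pp; compactness of the
Grassmannians gives a convergent subsequence of (Ann_k(g_t det_m))_k whose limit lies in pp^⊥ by
continuity of the pairing (BB Thm 1, necessity half); the set of such limits is a closed
Stab(pp)-stable subvariety of the projective variety Z_det, and H₀(n,m) is a connected (kernel of a
primitive character × unipotent) solvable (triangular) subgroup of Stab(pp), so Borel's fixed point
theorem yields an H₀-fixed limit (BB Thm 31, Fixed Ideal Theorem). Operators transform by D ↦ D∘Mᵀ
because D·(M·f) = M·((D∘Mᵀ)·f). [difficulty: XL] -/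
@[route_item "route-ValiantsHypothesis-BorderApolarity", crux]
def BorelFixedBorderApolarity : Prop :=
  ∀ (n m : ℕ) [NeZero m], 3 ≤ n → n ≤ m → let act := fun (D f : MvPolynomial (Fin m × Fin m) ℂ) => ∑ e ∈ D.support, ∑ d ∈ f.support, MvPolynomial.monomial (d - e) (MvPolynomial.coeff e D * MvPolynomial.coeff d f * ∏ i ∈ e.support, (Nat.descFactorial (d i) (e i) : ℂ)); let rk := fun (p : Fin m × Fin m) => (if (m - n ≤ (p.1 : ℕ) ∧ m - n ≤ (p.2 : ℕ)) ∨ p = (0, 0) then 0 else m * m) + ((p.1 : ℕ) * m + (p.2 : ℕ)); Literature.Computability.AlgebraicComplexity.paddedPerPoly ℂ n m ∈ Literature.Computability.AlgebraicComplexity.orbitClosure (Literature.Computability.AlgebraicComplexity.detPoly (Fin m) ℂ) → ∃ (P : ℕ → MvPolynomial (Fin m × Fin m) ℂ) (J : ℕ → Set (MvPolynomial (Fin m × Fin m) ℂ)), (∀ t : ℕ, P t ∈ Literature.Computability.AlgebraicComplexity.glOrbit (Fin m × Fin m) ℂ (Literature.Computability.AlgebraicComplexity.detPoly (Fin m) ℂ))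 ∧ (∀ k ≤ m, ∀ D ∈ J k, ∃ Ds : ℕ → MvPolynomial (Fin m × Fin m) ℂ, (∀ t, (Ds t).IsHomogeneous k ∧ act (Ds t) (P t) = 0) ∧ Filter.Tendsto (fun t => Literature.Computability.AlgebraicComplexity.coeffVec (Ds t)) Filter.atTop (nhds (Literature.Computability.AlgebraicComplexity.coeffVec D))) ∧ (∀ k ≤ m, ∀ (D : MvPolynomial (Fin m × Fin m) ℂ) (φ : ℕ → ℕ) (Ds : ℕ → MvPolynomial (Fin m × Fin m) ℂ), StrictMono φ → (∀ t, (Ds t).IsHomogeneous k ∧ act (Ds t) (P (φ t)) = 0) → Filter.Tendsto (fun t => Literature.Computability.AlgebraicComplexity.coeffVec (Ds t)) Filter.atTop (nhds (Literature.Computability.AlgebraicComplexity.coeffVec D)) → D ∈ J k) ∧ (∀ A : Matrix.GeneralLinearGroup (Fin m × Fin m) ℂ, let M : Matrix (Fin m × Fin m) (Fin m × Fin m) ℂ := A; (∀ i j : Fin m × Fin m, M j i ≠ 0 → rk j ≤ rk i) → (∀ i j : Fin m × Fin m, ((m - n ≤ (i.1 : ℕ) ∧ m - n ≤ (i.2 :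 ℕ)) ∨ i = (0, 0)) → j ≠ i → M j i = 0) → (∀ i k j l : Fin m, m - n ≤ (i : ℕ) → m - n ≤ (k : ℕ) → m - n ≤ (j : ℕ) → m - n ≤ (l : ℕ) → M (i, j) (i, j) * M (k, l) (k, l) = M (i, l) (i, l) * M (k, j) (k, j)) → M (0, 0) (0, 0) ^ (m - n) * ∏ i ∈ Finset.univ.filter (fun i : Fin m => m - n ≤ (i : ℕ)), M (i, i) (i, i) = 1 → ∀ k ≤ m, ∀ D ∈ J k, Literature.Computability.AlgebraicComplexity.linSubst (Fin m × Fin m) ℂ Mᵀ D ∈ J k) ∧ (∀ k ≤ m, ∀ D ∈ J k, act D (Literature.Computability.AlgebraicComplexity.paddedPerPoly ℂ n m) = 0)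

/-- item stmt-ValiantsHypothesis-5782 · support · rank 9 · closed · proved by Summit.ValiantsHypothesis.ValiantsHypothesis.Theorems.BorderApolarityFixedWitnessObstructionQP.witnessToMembership_holds (prover) · by planner
sources: BuczynskaBuczynski2021, LandsbergGCT2017, MulmuleySohoni2001
[support] converse (sufficiency half of border apolarity, elementary): for 3 ≤ n ≤ m a witness (P•,
J) as in crux 2 forces X₀₀^(m−n) per_n ∈ Δ(det_m) — J_m is a limit of the hyperplanes Ann_m(P_t) and
lies in the hyperplane Ann_m(pp), so [P_t] → [pp] by the perfect pairing ℂ[∂]_m × ℂ[x]_m → ℂ, hence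
pp is a Euclidean, hence Zariski, limit of GL·det_m. Records that crux 2 is pointwise no weaker and
no stronger than non-membership: the route's content is the normal form, not a weakening.
[difficulty: M] -/
@[route_item "route-ValiantsHypothesis-BorderApolarity"]
def WitnessToMembership : Prop :=
  ∀ (n m : ℕ) [NeZero m], 3 ≤ n → n ≤ m → let act := fun (D f : MvPolynomial (Fin m × Fin m) ℂ) => ∑ e ∈ D.support, ∑ d ∈ f.support, MvPolynomial.monomial (d - e) (MvPolynomial.coeff e D * MvPolynomial.coeff d f * ∏ i ∈ e.support, (Nat.descFactorial (d i) (e i) : ℂ)); let rk := fun (p : Fin m × Fin m) => (if (m - n ≤ (p.1 : ℕ) ∧ m - n ≤ (p.2 : ℕ)) ∨ p = (0, 0) then 0 else m * m) + ((p.1 : ℕ) * m + (p.2 : ℕ)); (∃ (P : ℕ → MvPolynomial (Fin m × Fin m) ℂ) (J : ℕ → Set (MvPolynomial (Fin m × Fin m) ℂ)), (∀ t : ℕ, P t ∈ Literature.Computability.AlgebraicComplexity.glOrbit (Fin m × Fin m) ℂ (Literature.Computability.AlgebraicComplexity.detPoly (Fin m) ℂ)) ∧ (∀ k ≤ m, ∀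 D ∈ J k, ∃ Ds : ℕ → MvPolynomial (Fin m × Fin m) ℂ, (∀ t, (Ds t).IsHomogeneous k ∧ act (Ds t) (P t) = 0) ∧ Filter.Tendsto (fun t => Literature.Computability.AlgebraicComplexity.coeffVec (Ds t)) Filter.atTop (nhds (Literature.Computability.AlgebraicComplexity.coeffVec D))) ∧ (∀ k ≤ m, ∀ (D : MvPolynomial (Fin m × Fin m) ℂ) (φ : ℕ → ℕ) (Ds : ℕ → MvPolynomial (Fin m × Fin m) ℂ), StrictMono φ → (∀ t, (Ds t).IsHomogeneous k ∧ act (Ds t) (P (φ t)) = 0) → Filter.Tendsto (fun t => Literature.Computability.AlgebraicComplexity.coeffVec (Ds t)) Filter.atTop (nhds (Literature.Computability.AlgebraicComplexity.coeffVec D)) → D ∈ J k) ∧ (∀ A : Matrix.GeneralLinearGroup (Fin m × Fin m) ℂ, let M : Matrix (Fin m × Fin m) (Fin m × Fin m) ℂ := A; (∀ i j : Fin m × Fin m, M j i ≠ 0 → rk j ≤ rk i) → (∀ i j : Fin m × Fin m, ((m - n ≤ (i.1 : ℕ) ∧ m - n ≤ (i.2 : ℕ)) ∨ i = (0, 0))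 → j ≠ i → M j i = 0) → (∀ i k j l : Fin m, m - n ≤ (i : ℕ) → m - n ≤ (k : ℕ) → m - n ≤ (j : ℕ) → m - n ≤ (l : ℕ) → M (i, j) (i, j) * M (k, l) (k, l) = M (i, l) (i, l) * M (k, j) (k, j)) → M (0, 0) (0, 0) ^ (m - n) * ∏ i ∈ Finset.univ.filter (fun i : Fin m => m - n ≤ (i : ℕ)), M (i, i) (i, i) = 1 → ∀ k ≤ m, ∀ D ∈ J k, Literature.Computability.AlgebraicComplexity.linSubst (Fin m × Fin m) ℂ Mᵀ D ∈ J k) ∧ (∀ k ≤ m, ∀ D ∈ J k, act D (Literature.Computability.AlgebraicComplexity.paddedPerPoly ℂ n m) = 0)) → Literature.Computability.AlgebraicComplexity.paddedPerPoly ℂ n m ∈ Literature.Computability.AlgebraicComplexity.orbitClosure (Literature.Computability.AlgebraicComplexity.detPoly (Fin m) ℂ)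

/-- item stmt-ValiantsHypothesis-5783 · assembly · rank 1 · closed · proved by Summit.ValiantsHypothesis.BorderApolarity.assembly_proof (prover) · by planner
sources: MulmuleySohoni2001, BuczynskaBuczynski2021
[assembly] FixedWitnessObstructionQP → BorelFixedBorderApolarity → GctBridge → ValiantsHypothesis. -/
@[route_item "route-ValiantsHypothesis-BorderApolarity"]
def Assembly : Prop :=
  FixedWitnessObstructionQP → BorelFixedBorderApolarity → GctBridge → ValiantsHypothesis

/-! D-0027 §2.1 — DECIDING THEOREM (planner-authored via `route open/edit --closes-file`; by planner-rrepair-ValiantsHypothesis-BorderApola-03b04f15-0 2026-08-16T06:33:42Z):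
its hypotheses are this route's items and its conclusion the sub-problem Statement (glue_lint), and it elaborates with this file. -/

@[closes "route-ValiantsHypothesis-BorderApolarity"] theorem closes (h_ToricFixedPoints : ToricFixedPoints)
    (h_ToricWitnessObstructionQP : ToricWitnessObstructionQP)
    (h_BorelFixedBorderApolarity : BorelFixedBorderApolarity) (h_GctBridge : GctBridge) :
    _root_.ValiantsHypothesis := by
  -- glued split of the thesis X (support item ToricReduction, pure logic):
  -- crux 3 (toric normal form of H₀-fixed limits) ∧ crux 4 (no toric witness) ⇒ crux 2 (no witness at all)
  have h_FixedWitnessObstructionQP : FixedWitnessObstructionQP := by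
    intro c
    obtain ⟨n₀, hn₀⟩ := h_ToricWitnessObstructionQP c
    refine ⟨max n₀ 3, ?_⟩
    intro n hn m inst hnm hm
    have h3n : 3 ≤ n := le_trans (le_max_right n₀ 3) hn
    have hn' : n ≥ n₀ := le_trans (le_max_left n₀ 3) hn
    have hWn := @hn₀ n hn' m inst hnm hm
    have hTn := @h_ToricFixedPoints n m inst h3n hnm
    simp only [] at hWn hTn ⊢
    rintro ⟨P, J, hP, hlo, hup, hstab, hpp⟩
    obtain ⟨u, g, w, hQ⟩ := hTn P J hP ⟨hlo, hup⟩ hstab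
    exact hWn ⟨u, g, w, J, hQ.1, hQ.2, hstab, hpp⟩
  -- X ⇒ qp Mulmuley–Sohoni non-membership (Borel-fixed border apolarity) ⇒ VH (GCT bridge)
  apply h_GctBridge
  intro c
  obtain ⟨n₀, hn₀⟩ := h_FixedWitnessObstructionQP c
  refine ⟨max n₀ 3, ?_⟩
  intro n hn m inst hnm hm hmem
  have h3n : 3 ≤ n := le_trans (le_max_right n₀ 3) hn
  have hn' : n ≥ n₀ := le_trans (le_max_left n₀ 3) hn
  exact (@hn₀ n hn' m inst hnm hm) (@h_BorelFixedBorderApolarity n m inst h3n hnm hmem)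

end Summit.ValiantsHypothesis.ValiantsHypothesis.Theses.BorderApolarity
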